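import Literature.NumberTheory.GaloisRepresentations.SerreWeight
import HarnessLib

/-!
# Serre's recipe at a level-one shape `(ψ₁^β ∗; 0 ψ₁^α)` with `1 ≤ β ≤ α ≤ q − 2`: the weight `1 + qβ + α`
# (tame or wild alike), and the evaluation of `k(ρ̄)` granted the uniqueness of the weight

Topic `NumberTheory/GaloisRepresentations`.  A *proofs* file (theorems only: no definition, no named fact, no `sorry`, no
instance, no notation).

* `isSerreWeight_of_hasLevelOneInertiaShape_of_le` — if `ρ̄|I_F ∼ (ψ₁^β ∗; 0 ψ₁^α)` (`HasLevelOneInertiaShape ι ϖ hϖ β α`: FIRST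
  exponent on the stable line) with `1 ≤ β ≤ α` and `α + 2 ≤ q`, then `m = 1 + q·β + α` is a Serre weight of `ρ̄` (`IsSerreWeight`):
  in the TAME case it is the level-one tame weight with normalised exponents `(a, b) = (β, α)`, `a ≤ b`, `(a, b) ≠ (0, 0)`
  (Serre 1987 (2.3.2)); in the WILD case it is the weight of §2.4 (i) with `min(α, β) = β`, `max = α`, and `β ≠ α + 1`.
  No diagonalisation is needed because both cases of the tree's recipe read the same shape predicate.
* `serreWeightLocal_eq_of_hasLevelOneInertiaShape_of_unique`, `serreWeight_eq_of_hasLevelOneInertiaShape_of_unique` — GRANTED the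
  uniqueness of the weight (named fact `IsSerreWeight.unique`, Serre 1987 §2.4 «α, β sont uniques»), `ι` injective, and that
  `k(ρ̄)` is a Serre weight (`isSerreWeight_serreWeightLocal`, a THEOREM of the tree: `SerreWeightRecipeProofs.isSerreWeight_serreWeightLocal_holds`,
  taken here as a hypothesis to keep the import light), `k(ρ̄) = 1 + q·β + α`.

Consumer: route BSD/TeichmullerTwistDescent, crux `TwistedPeriodLatticeSaturation`, input (W‴): `k(ω^b ⊗ ρ̄_E) = p + 1 + 2b` for the
shape `(1, 2b)` of the Teichmüller twist of an unstarred potentially good ordinary curve (Kraus 1997 Prop. 1 + twist).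
References: J.-P. Serre, Duke Math. J. 54 (1987), §2.3 (2.3.2), §2.4 (i) [Serre1987]; B. Edixhoven, Invent. Math. 109 (1992), §4.3
[Edixhoven1992].
-/

noncomputable section

open scoped Valued
open Field ValuativeRel

namespace Literature.NumberTheory.GaloisRepresentations

namespace ModPGaloisRep

open GaloisRepresentations.IsNonarchimedeanLocalField

universe u v

variable {F : Type u} [Field F] [ValuativeRel F] [TopologicalSpace F] [IsNonarchimedeanLocalField F]
variable {k : Type v} [Field k] [TopologicalSpace k]

/-- **`1 + qβ + α` is a Serre weight of a representation of level-one shape `(ψ₁^β ∗; 0 ψ₁^α)`, `1 ≤ β ≤ α ≤ q − 2`** — the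
tame case (2.3.2) with `(a, b) = (β, α)` and the wild case §2.4 (i) (`β ≠ α + 1`, `min = β`, `max = α`) give the same number.
[cite: Serre1987, §2.3 (2.3.2) and §2.4 (i)] -/
theorem isSerreWeight_of_hasLevelOneInertiaShape_of_le (ρ : ModPGaloisRep F k 2)
    (ι : absIntegers 𝒪[F] F ⧸ absMaximalIdeal F →+* k) {ϖ : 𝒪[F]} (hϖ : Irreducible ϖ) {β α : ℕ}
    (h : ρ.HasLevelOneInertiaShape ι ϖ hϖ β α) (hβ : 1 ≤ β) (hβα : β ≤ α) (hα : α + 2 ≤ residueFieldCard F) :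
    ρ.IsSerreWeight ι (1 + residueFieldCard F * β + α) := by
  by_cases ht : ρ.IsTamelyRamified
  · refine Or.inr (Or.inl ⟨ht, β, α, hβα, hα, ⟨ϖ, hϖ, h⟩, ?_⟩)
    rw [if_neg (by rintro ⟨h0, -⟩; omega)]
  · refine Or.inr (Or.inr ⟨ht, α, β, hα, hβ, by omega, ⟨ϖ, hϖ, h⟩, ?_⟩)
    rw [if_neg (by rintro ⟨h0, -⟩; omega), min_eq_right hβα, max_eq_left hβα]

/-- **`k(ρ̄_F) = 1 + qβ + α` granted uniqueness of the weight**: `serreWeightLocal ρ ι` is a Serre weight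
(hypothesis `hS`, discharged in the tree by `isSerreWeight_serreWeightLocal_holds`) and so is `1 + qβ + α`; the named fact
`IsSerreWeight.unique` (with `ι` injective) identifies them. [cite: Serre1987, §2.4 (unicité de α, β)] -/
theorem serreWeightLocal_eq_of_hasLevelOneInertiaShape_of_unique [DiscreteTopology k] (ρ : ModPGaloisRep F k 2)
    (ι : absIntegers 𝒪[F] F ⧸ absMaximalIdeal F →+* k) (hU : IsSerreWeight.unique ρ ι) (hι : Function.Injective ι)
    (hS : ρ.isSerreWeight_serreWeightLocal ι)
    {ϖ : 𝒪[F]} (hϖ : Irreducible ϖ) {β α : ℕ} (h : ρ.HasLevelOneInertiaShape ι ϖ hϖ β α) (hβ : 1 ≤ β) (hβα : β ≤ α)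
    (hα : α + 2 ≤ residueFieldCard F) :
    ρ.serreWeightLocal ι = 1 + residueFieldCard F * β + α :=
  hU hι hS (isSerreWeight_of_hasLevelOneInertiaShape_of_le ρ ι hϖ h hβ hβα hα)

/-- **Global form: `k(ρ̄) = 1 + pβ + α`** for `ρ̄ : Γ_ℚ → GL₂(k)` at a local restriction datum `loc` at `p` whose local
representation has level-one shape `(ψ₁^β ∗; 0 ψ₁^α)` w.r.t. the uniformiser `p`, `1 ≤ β ≤ α ≤ p − 2`, granted uniqueness of the
weight. [cite: Serre1987, §2.3 (2.3.2), §2.4 (i)] -/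
theorem serreWeight_eq_of_hasLevelOneInertiaShape_of_unique {k : Type v} [Field k] [TopologicalSpace k] [DiscreteTopology k]
    {p : ℕ} {ρ : ModPGaloisRep ℚ k 2} (loc : LocalRestrictionAt p ρ)
    (ι : absIntegers 𝒪[loc.F] loc.F ⧸ absMaximalIdeal loc.F →+* k) (hU : IsSerreWeight.unique loc.rep ι)
    (hι : Function.Injective ι) (hS : loc.rep.isSerreWeight_serreWeightLocal ι) {β α : ℕ}
    (h : loc.rep.HasLevelOneInertiaShape ι ((p : ℕ) : 𝒪[loc.F]) loc.irreducible_natCast β α)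
    (hβ : 1 ≤ β) (hβα : β ≤ α) (hα : α + 2 ≤ p) :
    serreWeight p ρ loc ι = 1 + p * β + α := by
  have hq : residueFieldCard loc.F = p := loc.residueFieldCard_eq
  have h1 := serreWeightLocal_eq_of_hasLevelOneInertiaShape_of_unique loc.rep ι hU hι hS loc.irreducible_natCast h hβ hβα
    (hq.symm ▸ hα)
  rw [hq] at h1
  exact h1

end ModPGaloisRep

end Literature.NumberTheory.GaloisRepresentations
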